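import Mathlib
import Literature.NumberTheory.Sieve.Maynard2016Lemma7Assembly
import Literature.NumberTheory.Sieve.Maynard2016J1Expand
import HarnessLib

/-!
# Maynard (2016), Lemma 7: the main term `Lemma7MainLower` from the one-pair engine bound

J. Maynard, *Large gaps between primes*, Ann. of Math. (2) 183 (2016), 915–933 = arXiv:1408.5110,
§6, proof of Lemma 7, displays (6.29)–(6.33) ("By an argument analogous to that of Lemma 6 …").

The named fact `Lemma7MainLower` of `Maynard2016Lemma7Assembly` (the main term of the solvable-tuple
sum `S_i`) is reduced to the ONE-PAIR bound `Lemma7PairBound` for the `φ`-weighted coupled sums of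
`Maynard2016CoupledBoxW` on the `k − 1` free slots `{ℓ // ℓ ≠ i}` — the exact analogue of
`eventually_norm_logpow_mul_coupledLcmSum_sub_le` (Lemma 6, `Maynard2016Lemma6PairBound`) with weight
`phiInv`, coupling `restrictPairs i i (couplingSet7)` and singular series `𝔖_small^{(k−1)} · N⁷`:
`lemma7MainLower_of_pairBound : Lemma7PairBound → Lemma7MainLower`, by expanding
`S_i = Σ_{j,j'} c_j c_{j'} F_{i,j}(0) F_{i,j'}(0) G(0)² · S^φ_{j,j'}` (`ofReal_solvSum_eq_coupledLcmSumW`)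
and `J₁^{(i)} J₂ = Σ_{j,j'} c_j c_{j'} F_{i,j}(0) F_{i,j'}(0) G(0)² · c_{j,j'}`
(`IsSieveData.J1_eq_sum_subtype`, `J2_eq_prod_subtype`).

## References

* J. Maynard, *Large gaps between primes*, Ann. of Math. (2) 183 (2016), 915–933; arXiv:1408.5110,
  §6, displays (6.29)–(6.33). [Maynard2016LargeGaps]
-/

noncomputable section

open Filter Finset Real MeasureTheory
open scoped BigOperators Topology

namespace Literature.NumberTheory.Sieve

namespace Maynard2016

open LcmEuler

/-- The model constant `c = (∏_ℓ ∫_0^∞ F_ℓ' F_ℓ'') (∏_ℓ ∫_0^∞ G_ℓ' G_ℓ'')` of (6.19) on general index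
types (the `pairConst` of `Maynard2016Lemma6PairBound` is the case `ι = κ = Fin k`).
[cite: Maynard2016LargeGaps, §6 display (6.19)] -/
def pairConst7 {ι κ : Type*} [Fintype ι] [Fintype κ] (F F' : ι → ℝ → ℝ) (G G' : κ → ℝ → ℝ) : ℂ :=
  (∏ l, ((∫ t in Set.Ioi (0 : ℝ), deriv (F l) t * deriv (F' l) t : ℝ) : ℂ)) *
    ∏ l, ((∫ t in Set.Ioi (0 : ℝ), deriv (G l) t * deriv (G' l) t : ℝ) : ℂ)

/-- **Lemma 7, one pair of cutoffs on the free slots, uniformly in `m, p₀`** ((6.29)–(6.33); the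
analogue of `eventually_norm_logpow_mul_coupledLcmSum_sub_le`): for `k`, a slot `i`, smooth cutoffs
`F_ℓ, F'_ℓ, G_ℓ, G'_ℓ` (`ℓ ≠ i`) supported in `[0, 1]`, `0 < ε ≤ 1/2` and `η > 0`: eventually in `x`,
for all `1 ≤ m ≤ x` and primes `x < p₀ ≤ x²`,
`‖(log x)^{k−1} (log y)^{k−1} S^φ − 𝔖 c‖ ≤ η 𝔖`, where
`S^φ = coupledLcmSumW phiInv (P_w) m (restrictPairs i i (couplingSet7 p₀ i)) F F' G G' x y x`,
`c = pairConst7 F F' G G'` and `𝔖 = singSmall (k−1) x · nuProd7 k x m p₀ i`.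
Route: `coupledLcmSumW_eq_integral_freqKernel`, `coupledKernelW_eq_prod` (`K = E·N⁷·Z·Z'`),
`norm_coupledEpsProdW_sub_one_le` with `Σ_{p ∈ Bad⁷} log p/p ≤ (log₂ x + O_k(1))²`, the `ζ_W`-ratio
estimate on the cube and `eventually_norm_logpow_mul_kernelW_le` on the tails.
[cite: Maynard2016LargeGaps, Lemma 7 (proof, displays (6.29)–(6.33))] -/
def Lemma7PairBound : Prop :=
  ∀ (k : ℕ) (i : Fin k) (F F' G G' : {l : Fin k // l ≠ i} → ℝ → ℝ)
    (sF sF' sG sG' : {l : Fin k // l ≠ i} → ℝ),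
    (∀ l, IsSieveCutoff (F l) (sF l)) → (∀ l, IsSieveCutoff (F' l) (sF' l)) →
    (∀ l, IsSieveCutoff (G l) (sG l)) → (∀ l, IsSieveCutoff (G' l) (sG' l)) →
    (∀ l, sF l ≤ 1 ∧ sF' l ≤ 1) → (∀ l, sG l ≤ 1 ∧ sG' l ≤ 1) →
    ∀ ε : ℝ, 0 < ε → ε ≤ 1 / 2 → ∀ η : ℝ, 0 < η →
      ∀ᶠ x : ℕ in atTop, ∀ m p₀ : ℕ, 1 ≤ m → m ≤ x → p₀.Prime → x < p₀ → (p₀ : ℝ) ≤ (x : ℝ) ^ 2 →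
        ‖(Real.log x : ℂ) ^ (k - 1) * (Real.log (y ε x) : ℂ) ^ (k - 1) *
              coupledLcmSumW phiInv (Pw x) m (restrictPairs i i (couplingSet7 k x m p₀ i))
                F F' G G' (x : ℝ) (y ε x) x -
            ((singSmall (k - 1) x * nuProd7 k x m p₀ i : ℝ) : ℂ) * pairConst7 F F' G G'‖ ≤
          η * (singSmall (k - 1) x * nuProd7 k x m p₀ i)

set_option maxHeartbeats 800000 in
/-- **`Lemma7PairBound → Lemma7MainLower`** ("the corresponding sums then differ only in the main
term: `J^{(1)}, J^{(2)}` in place of `I^{(1)}, I^{(2)}`", display (6.33)).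
[cite: Maynard2016LargeGaps, Lemma 7 (proof, displays (6.32)–(6.33))] -/
theorem lemma7MainLower_of_pairBound (hPB : Lemma7PairBound) : Lemma7MainLower := by
  intro k J c Fd G hk hD ε hε0 hε η hη
  classical
  -- one slot `i` at a time
  suffices hi : ∀ i : Fin k, ∀ᶠ x : ℕ in atTop, ∀ m : ℕ, 1 ≤ m → m ≤ x → ∀ p₀ : ℕ, p₀.Prime →
      x < p₀ → (p₀ : ℝ) ≤ (x : ℝ) ^ 2 → Nat.Coprime (m * p₀ - 1) (primorial ⌊y ε x⌋₊) →
        (J1 c Fd i * J2 k G - η) * (singSmall (k - 1) x * nuProd7 k x m p₀ i) ≤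
          (Real.log x) ^ (k - 1) * (Real.log (y ε x)) ^ (k - 1) * solvSum c Fd G ε x m p₀ i by
    filter_upwards [Filter.eventually_all.2 hi] with x hx m hm hmx p₀ hp hxp hp2 hcop i
    exact hx i m hm hmx p₀ hp hxp hp2 hcop
  intro i
  -- the accuracy demanded of each pair
  set Cabs : ℝ := ∑ j, ∑ j', |c j * c j' * (Fd i j 0 * Fd i j' 0 * (G 0 * G 0))| with hCabs
  have hCabs0 : 0 ≤ Cabs := by positivity
  set η₁ : ℝ := η / (Cabs + 1) with hη₁
  have hη₁0 : 0 < η₁ := by positivity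
  have hη₁C : η₁ * Cabs ≤ η := by
    rw [hη₁, div_mul_eq_mul_div, div_le_iff₀ (by positivity)]
    nlinarith
  -- the one-pair estimates, for all pairs at once
  have hpair : ∀ jj : Fin J × Fin J, ∀ᶠ x : ℕ in atTop, ∀ m p₀ : ℕ, 1 ≤ m → m ≤ x → p₀.Prime →
      x < p₀ → (p₀ : ℝ) ≤ (x : ℝ) ^ 2 →
        ‖(Real.log x : ℂ) ^ (k - 1) * (Real.log (y ε x) : ℂ) ^ (k - 1) *
              coupledLcmSumW phiInv (Pw x) m (restrictPairs i i (couplingSet7 k x m p₀ i))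
                (fun l : {l : Fin k // l ≠ i} => Fd l.1 jj.1) (fun l => Fd l.1 jj.2)
                (fun _ => G) (fun _ => G) (x : ℝ) (y ε x) x -
            ((singSmall (k - 1) x * nuProd7 k x m p₀ i : ℝ) : ℂ) *
              pairConst7 (fun l : {l : Fin k // l ≠ i} => Fd l.1 jj.1) (fun l => Fd l.1 jj.2)
                (fun _ : {l : Fin k // l ≠ i} => G) (fun _ => G)‖ ≤
          η₁ * (singSmall (k - 1) x * nuProd7 k x m p₀ i) := fun jj =>
    hPB k i (fun l => Fd l.1 jj.1) (fun l => Fd l.1 jj.2) (fun _ => G) (fun _ => G)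
      (fun _ => 1 / 10) (fun _ => 1 / 10) (fun _ => 1) (fun _ => 1)
      (fun l => hD.isSieveCutoff_Fd l.1 jj.1) (fun l => hD.isSieveCutoff_Fd l.1 jj.2)
      (fun _ => hD.isSieveCutoff_G) (fun _ => hD.isSieveCutoff_G)
      (fun _ => ⟨by norm_num, by norm_num⟩) (fun _ => ⟨le_rfl, le_rfl⟩) ε hε0 hε η₁ hη₁0
  -- `J₁^{(i)} J₂ = Σ c_j c_j' F_{i,j}(0) F_{i,j'}(0) G(0)² · pairConst7`
  have hJ : ((J1 c Fd i * J2 k G : ℝ) : ℂ) = ∑ j, ∑ j', (c j : ℂ) * c j' *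
      ((Fd i j 0 : ℂ) * Fd i j' 0 * G 0 * G 0 *
        pairConst7 (fun l : {l : Fin k // l ≠ i} => Fd l.1 j) (fun l => Fd l.1 j')
          (fun _ : {l : Fin k // l ≠ i} => G) (fun _ => G)) := by
    have hreal : J1 c Fd i * J2 k G = ∑ j, ∑ j', c j * c j' * (Fd i j 0 * Fd i j' 0 * (G 0 * G 0) *
        ((∏ l : {l : Fin k // l ≠ i}, ∫ t in Set.Ioi (0 : ℝ), deriv (Fd l.1 j) t * deriv (Fd l.1 j') t) *
          ∏ _l : {l : Fin k // l ≠ i}, ∫ t in Set.Ioi (0 : ℝ), deriv G t * deriv G t)) := by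
      rw [hD.J1_eq_sum_subtype i, J2_eq_prod_subtype k G i, Finset.sum_mul]
      refine Finset.sum_congr rfl fun j _ => ?_
      rw [Finset.sum_mul]
      refine Finset.sum_congr rfl fun j' _ => ?_
      ring
    rw [hreal]
    push_cast
    refine Finset.sum_congr rfl fun j _ => Finset.sum_congr rfl fun j' _ => ?_
    unfold pairConst7
    push_cast
    ring
  filter_upwards [Filter.eventually_all.2 hpair, eventually_prime_dvd_Pw_of_dvd_hTuple_sub k,
    eventually_iteratedLogs, eventually_wTrick hε, eventually_gt_atTop 0] with x hx hW hlogs hwt hx0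
  obtain ⟨hL4, -, -, -, -, -, -⟩ := hlogs
  obtain ⟨-, hly0, -, -, -, -⟩ := hwt
  intro m hm hmx p₀ hp hxp hp2 hcop
  have hL0 : 0 < Real.log x := by linarith
  set S₀ : ℝ := singSmall (k - 1) x * nuProd7 k x m p₀ i with hS₀
  have hS0 : 0 ≤ S₀ := by
    have := singSmall_pos (k - 1) x
    have := one_le_nuProd7 k x m p₀ i
    positivity
  set L : ℂ := (Real.log x : ℂ) ^ (k - 1) * (Real.log (y ε x) : ℂ) ^ (k - 1) with hLdef
  have key : ∀ j j' : Fin J,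
      ‖L * coupledLcmSumW phiInv (Pw x) m (restrictPairs i i (couplingSet7 k x m p₀ i))
              (fun l : {l : Fin k // l ≠ i} => Fd l.1 j) (fun l => Fd l.1 j')
              (fun _ => G) (fun _ => G) (x : ℝ) (y ε x) x -
          (S₀ : ℂ) * pairConst7 (fun l : {l : Fin k // l ≠ i} => Fd l.1 j) (fun l => Fd l.1 j')
            (fun _ : {l : Fin k // l ≠ i} => G) (fun _ => G)‖ ≤ η₁ * S₀ :=
    fun j j' => hx (j, j') m p₀ hm hmx hp hxp hp2
  -- the difference as a double sum
  have hsolv := ofReal_solvSum_eq_coupledLcmSumW hD (by omega) hL0 hly0 hp hm hxp hcop hW i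
  have hdiff : (((Real.log x) ^ (k - 1) * (Real.log (y ε x)) ^ (k - 1) * solvSum c Fd G ε x m p₀ i -
      S₀ * (J1 c Fd i * J2 k G) : ℝ) : ℂ) =
      ∑ j, ∑ j', (c j : ℂ) * c j' * ((Fd i j 0 : ℂ) * Fd i j' 0 * G 0 * G 0) *
        (L * coupledLcmSumW phiInv (Pw x) m (restrictPairs i i (couplingSet7 k x m p₀ i))
              (fun l : {l : Fin k // l ≠ i} => Fd l.1 j) (fun l => Fd l.1 j')
              (fun _ => G) (fun _ => G) (x : ℝ) (y ε x) x -
          (S₀ : ℂ) * pairConst7 (fun l : {l : Fin k // l ≠ i} => Fd l.1 j) (fun l => Fd l.1 j')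
            (fun _ : {l : Fin k // l ≠ i} => G) (fun _ => G)) := by
    have e1 : (((Real.log x) ^ (k - 1) * (Real.log (y ε x)) ^ (k - 1) *
        solvSum c Fd G ε x m p₀ i : ℝ) : ℂ) = L * ((solvSum c Fd G ε x m p₀ i : ℝ) : ℂ) := by
      rw [Complex.ofReal_mul, Complex.ofReal_mul, Complex.ofReal_pow, Complex.ofReal_pow, hLdef]
    have e2 : ((S₀ * (J1 c Fd i * J2 k G) : ℝ) : ℂ) = (S₀ : ℂ) * ((J1 c Fd i * J2 k G : ℝ) : ℂ) := by
      rw [Complex.ofReal_mul]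
    rw [Complex.ofReal_sub, e1, e2, hsolv, hJ, Finset.mul_sum, Finset.mul_sum,
      ← Finset.sum_sub_distrib]
    refine Finset.sum_congr rfl fun j _ => ?_
    rw [Finset.mul_sum, Finset.mul_sum, ← Finset.sum_sub_distrib]
    refine Finset.sum_congr rfl fun j' _ => ?_
    ring
  have habs : |(Real.log x) ^ (k - 1) * (Real.log (y ε x)) ^ (k - 1) * solvSum c Fd G ε x m p₀ i -
      S₀ * (J1 c Fd i * J2 k G)| ≤ η * S₀ := by
    rw [← Real.norm_eq_abs, ← Complex.norm_real, hdiff]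
    calc ‖∑ j, ∑ j', (c j : ℂ) * c j' * ((Fd i j 0 : ℂ) * Fd i j' 0 * G 0 * G 0) *
          (L * coupledLcmSumW phiInv (Pw x) m (restrictPairs i i (couplingSet7 k x m p₀ i))
                (fun l : {l : Fin k // l ≠ i} => Fd l.1 j) (fun l => Fd l.1 j')
                (fun _ => G) (fun _ => G) (x : ℝ) (y ε x) x -
            (S₀ : ℂ) * pairConst7 (fun l : {l : Fin k // l ≠ i} => Fd l.1 j) (fun l => Fd l.1 j')
              (fun _ : {l : Fin k // l ≠ i} => G) (fun _ => G))‖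
        ≤ ∑ j, ∑ j', |c j * c j' * (Fd i j 0 * Fd i j' 0 * (G 0 * G 0))| * (η₁ * S₀) := by
          refine (norm_sum_le _ _).trans (Finset.sum_le_sum fun j _ =>
            (norm_sum_le _ _).trans (Finset.sum_le_sum fun j' _ => ?_))
          rw [norm_mul]
          refine mul_le_mul ?_ (key j j') (norm_nonneg _) (abs_nonneg _)
          rw [show (c j : ℂ) * c j' * ((Fd i j 0 : ℂ) * Fd i j' 0 * G 0 * G 0) =
              ((c j * c j' * (Fd i j 0 * Fd i j' 0 * (G 0 * G 0)) : ℝ) : ℂ) by push_cast; ring,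
            Complex.norm_real, Real.norm_eq_abs]
      _ = η₁ * Cabs * S₀ := by
          rw [hCabs]
          simp_rw [← Finset.sum_mul]
          ring
      _ ≤ η * S₀ := mul_le_mul_of_nonneg_right hη₁C hS0
  have h1 := (abs_le.1 habs).1
  nlinarith

end Maynard2016

end Literature.NumberTheory.Sieve

end
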